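import Summits.BirchSwinnertonDyer.Rank1Residual.Additive.QuadraticBranchMinusLeadingValuation
import Literature.NumberTheory.EllipticCurves.Rank1Residual.ClassX1KellerYinCertificate
import Literature.NumberTheory.EllipticCurves.Disegni2020.PAdicBSDRankOneMultiplicativeProofs
import Summits.BirchSwinnertonDyer.Rank1Residual.AdditivePotMult.OneSided
import HarnessLib

/-!
# (C3_η) TYPED (`@[conjecture]`, MISSING INPUT; NOTHING asserted): EXACT bottom-layer control on the
# odd `η`-branch given the branch main conjecture (C1_η), the ELEMENTARY typed index
# `#Sel_str(W/ℚ)[p^∞] = p^ν · #Ш(W)[p^∞]`, and the PROVED consumer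
# "(C1_η) ∧ (C2_η-GZ) ∧ (C3_η) (+ the index) ⟹ `BSD(W, p)`, `PPart W p`" refining
# `QuadraticBranchRankOneLinkAt` (p254895) — cell `b2b-bsdres`, lane CLASS-CLOSURE, seat cc-typer-6
# GEN 15 = pen; x1b GEN 29 AMENDMENT 1 §B–§C ("CONSUMER to type"); sibling of
# `QuadraticBranchPAdicGrossZagierValuation` ((C2_η-GZ) valuation content = the law
# `QuadraticBranchMinusLeadingValuationAt W p 0`, EVIDENCE-labelled there); classes served by the
# data: O10-PS (CM), O7-ss ∩ `e = 2` / O5a (non-CM) — all stay OPEN / CONSTRUCTION-SHAPED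

HONEST FRAMING (cell `b2b-bsdres`, run/shared/lean/b2b/bsd-rank1-residual/, verbatim in every
file): the goal of the cell is to DELETE the COMBINATION-SHAPED residual classes of the
Birch–Swinnerton-Dyer formula for ALL analytic-rank `≤ 1` elliptic curves over `ℚ` — "full BSD
formula for every rank `≤ 1` curve in class `C`" assembled STRICTLY from published theorems — so
that the rank-`≤ 1` remainder becomes exactly the CONSTRUCTION-SHAPED classes, which are TYPED
(missing-input `Prop`s), NOT attempted. This is not "finishing BSD". CLASS-CLOSURE lane: prove
what is provable now; shrink each hard class to its core with data; no claim beyond stated classes;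
research routes on CONSTRUCTION-SHAPED X12 / O10; census / instrument output = EVIDENCE / conjecture
items, NEVER a Literature fact; `RESIDUAL-MAP.md` marks change only by signed lines. THIS FILE: two
`@[conjecture] def`s (one MISSING INPUT (C3_η); one ELEMENTARY typed input, theorem-level) and
PROVED bookkeeping; NO named Literature fact, NO Summits-side fact `def`, net debt `0`, no `sorry`;
nothing is booked; no label / mark / count / sub-cell moves; nothing about `BSD(W, p)` of any pair
is claimed.

## The consumer (x1b GEN 29 AMENDMENT 1 §B–§C): why three inputs, and what is proved here

`(C1_η)(V)` = `QuadraticBranchPlusMainConjectureAt V p` (Kobayashi's branch main conjecture for the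
good `a_p = 0` twin `V`; CONJECTURE IN PRINT; p254895) ⟹ by Thm. 7.4 the odd one
`Char X⁻(V/K_∞)^η = (X⁻¹L_p⁻(V,η,X))`; CONTROL at the bottom layer of the odd branch
(`Sel⁻(V/ℚ(μ_p))^η = Sel_str(W/ℚ)[p^∞]`, the `p`-STRICT group of `W = V ⊗ η`, finite in rank one)
with its Euler-characteristic bookkeeping expresses `#Sel_str(W/ℚ)[p^∞] · p^ν · ∏_ℓ #(local control
kernels)_p = |coeff₁ L⁻_η|_p⁻¹` — THIS is the typed MISSING INPUT **(C3_η)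
`QuadraticBranchOddStrictExactControlOfPlusMCAt`** (§2; the EXACT twin of the typed inequality
`QuadraticBranchOddStrictSelmerBoundOfPlusMCAt`, p259634); the snake lemma on
`Sel_{p^∞}(W/ℚ) → W(ℚ_p) ⊗ ℚ_p/ℤ_p` gives `#Sel_str = p^ν · #Ш(W)[p^∞]` — the ELEMENTARY typed input
**`StrictSelmerIndexAt`** (§3, sibling of `StrictSelmerDominatesShaAt`, which n1011-p01 DISCHARGED as
`StrictSha.strictSelmerDominatesShaAt_holds`); and (C2_η-GZ) — the valuation content
`QuadraticBranchMinusLeadingValuationAt W p 0` (= `QuadraticBranchPAdicGrossZagierValuationAt W p` of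
the sibling file, `Iff.rfl`) — converts `v_p(coeff₁ L⁻_η)` into `2ν + ord_p(L′(W,1)/(Ω_W Reg(W)))`
= `2ν + ord_p(#Ш_an·∏c_ℓ/#tors²)`. Comparing exponents: `ord_p #Ш(W)(p) = ord_p #Ш_an(W)` — BOTH
halves, Miller's `BSD(W, p)`, hence `PPart W p` and `MissingPPartAt W p`:
**`bsdp_of_quadraticBranchPAdicGrossZagierValuation_of_exactControl`** (§4, PROVED arithmetic over
the typed inputs; `#Ш_an ∈ ℚ` from Gross–Zagier I.(7.3) `hGZ`, `L′(W,1) ≠ 0` from modularity `hmod`,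
`rank = r_an` and finiteness from GZK `hGZK`). This is the honest decomposition of p254895's one-arrow
`QuadraticBranchRankOneLinkAt` ("(C1_η) ⟹ PPart"): MC + (C2_η-GZ) + control is Perrin-Riou's argument
on the branch; the experiment's agreement 'with `#Ш_an`' is evidence for (C2_η-GZ), not for `BSD_p`
(the identity never sees the true Ш); the `#Ш`-form of the GEN 28 memo §4 (`QuadraticBranchPAdicBSDAt`)
is NOT typed — given (C1_η) and (C3_η) its valuation is a consequence, and as a consumer input it
would be circular in spirit (AMENDMENT 1 §B).

NOT typed / unchanged: the local RECIPE of (C3_η) beyond its total exponent (§2 docstring: CANDIDATE,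
derivation = prover target); O10-SC (`e ∈ {3,4,6}`); O11 ((M2) of `O11/M123-STATEMENTS-x1b.md` reads
in the same Ш-free form — x1b GEN 29 §D); x1b's RULING a8bd8e04d6a47657 respected (the O10 node of
record stays `X12.O10.LowerHalfOnType` ⟸ (C1_η) ∧ (C2_η), p255460; this file is NOT an O10 route).
EVIDENCE pointers for (C3_η)'s total exponent: P2♭-VAL report
`class-closure/O10/E1-P2FLAT-VAL-2026-08-21.md` dcf6a17d7756df77 ('237 rows run' — census-lead
A-220's wording, HOME INBOX l.7544 / ttrl requests l.2084, entered by cc-typer-6 GEN 18,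
docstring-only: controls c1 / c3 237/237, c2 exact path 81/81 and p-adic path 148/157, the 9 c2
failures being the CONTROL FAILURES of record, clean on their one registered re-measurement =
supplement; NOT '237 control-clean rows'; valuation law 232/232) and E1-η 274/274 O10-PS
(`E1-ETA-SCORE2-v2-typer6.md`), where `BSD_p` is decided per pair of record (T-KR / T-MN19).

References (locators only): [Kobayashi2003] §2 p. 4 (`m = −1`), §4 + Thm. 4.1 p. 8, Thm. 7.4 p. 13,
Lemma 9.1 p. 25, Thm. 9.3 p. 26; [GreenbergLNM1716] §2 pp. 62–63, §3 Lemma 3.3, §4 Lemma 4.2 p. 102;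
[KitajimaOtsuki2018] Main Thm. 1.3; [KuriharaPollack2007] §1.5 p. 361; [SilvermanAEC2009] VII.6.3;
[GrossZagier1986] Thm. I.(7.3); [Miller2011LMS] §1, Def. 1.1; [Darmon2004] Thm. 3.22; [YanZhu2026]
Thm. 4.15 (display).
-/

noncomputable section

open scoped Classical MatrixGroups ModularForm

open CongruenceSubgroup WeierstrassCurve Literature.NumberTheory.EllipticCurves
  Literature.NumberTheory.EllipticCurves.ModularForms
  Literature.NumberTheory.EllipticCurves.Kobayashi2003
  Literature.NumberTheory.EllipticCurves.Rank1Residual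
  Literature.NumberTheory.EllipticCurves.Rank1Residual.Typed

namespace Summit.BirchSwinnertonDyer.Rank1Residual.Additive

/-! ## §2 (C3_η): EXACT bottom-layer control on the odd branch, given (C1_η) — typed MISSING INPUT -/

/-- **(C3_η) TYPED MISSING INPUT (`@[conjecture]`; NOTHING asserted): exact control / Euler
characteristic at the bottom layer of the odd `η`-branch, GIVEN the branch main conjecture (C1_η).**
For `W/ℚ` globally minimal of analytic rank one, `p ≥ 5`, the good `a_p = 0` twin `V`
(`C • W^{(p*)} = V`) satisfying `QuadraticBranchPlusMainConjectureAt V p` (⟺ the odd main conjecture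
`Char X⁻(V/K_∞)^η = (X⁻¹L_p⁻(V, η, X))` by Thm. 7.4), every `L` with
`IsQuadraticBranchMinusLFunction f p ϖ L`, `W(ℚ_p)` without points of order `p`, `P` a generator of
`W(ℚ)` modulo torsion of `p`-divisibility level `n = ν(W, p)` in `W(ℚ_p)`, and `coeff₁ L ≠ 0`:
**`Sel_str(W/ℚ)[p^∞]` is finite and `ord_p #Sel_str(W/ℚ)[p^∞] + ν + ord_p(Tam(W)/#W(ℚ)_tors²) =
v_p(coeff₁ L)`** — x1b GEN 29 AMENDMENT 1 §B/§C: "`#Sel_str(W/ℚ)[p^∞] · p^ν · ∏_ℓ #(local control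
kernels)_p = |coeff₁ L⁻_η(V)|_p⁻¹` up to `ℤ_p^×`" (`Sel⁻(V/ℚ(μ_p))^η = Sel_str(W/ℚ)[p^∞]` by the
`m = −1` clause; the second `p^ν` is the index at `p` of the localised generator in the `η`-component
of the minus local condition — the generator is invisible to the strict condition except through its
local `p`-divisibility; `∏_{ℓ} c_ℓ(W)^{(p)}` at `ℓ ≠ p`, and `c_p(W) ∈ {1, 2, 4}` for type `I₀*` is
prime to `p ≥ 5`; `#W(ℚ)[p] = 1` under the `W(ℚ_p)`-hypothesis). It is the EXACT twin of the typed
INEQUALITY `QuadraticBranchOddStrictSelmerBoundOfPlusMCAt` (p259634: `ord_p #Sel_str ≤ v_p(coeff₁ L)`,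
Kato-direction + control injectivity). STATUS OF THE LOCAL RECIPE — CANDIDATE, NOT DERIVED HERE: the
TOTAL exponent `ν + ord_p(Tam/#tors²)` is the unique one consistent with the engine record (x1b: "the
rows force total p-exponent `2ν + ord_p(∏c_ℓ·#Ш/#tors²)` on the Selmer side"; 237 P2♭-VAL rows +
274 E1-η O10-PS rows where `BSD_p` is DECIDED per pair by T-KR / T-MN19, so `#Sel_str = p^ν` there by
§3) — READ OFF the record, hence NOT a prediction the record can confirm; its support is the
DERIVATION, a PROVER / class-lead target: Kobayashi 2003 Thm. 9.3 (control: finite bounded kernel and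
cokernel) + Lemma 9.1 + Greenberg LNM 1716 §3 Lemma 3.3 (local kernels `c_ℓ^{(p)}`) and §4 Lemma 4.2
(`f(0) ∼ #X_Γ/#X^Γ`) + Kitajima–Otsuki 2018 Main Thm. 1.3 (no finite submodule) on the `η`-component,
with the Cassels–Poitou–Tate bookkeeping of the global-to-local cokernel in rank one; x1b checks any
derived recipe against the 237 + 81 rows. (In analytic rank ZERO the bottom layer DEGENERATES:
there `coeff₁ L_p⁻(V, η, X) = 0` — E1-η's K0 twins have order pattern `(2, 0)`, 510/510, EVIDENCE —
consistent with the `η`-component of the minus condition being a local condition at `p` different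
from the Kummer one, so that the Selmer parity flips; hence the hypothesis `coeff₁ L ≠ 0`, which
(C2_η-GZ) supplies in analytic rank one.)
Label: MISSING INPUT (C3_η); CONJECTURE-LEVEL only through (C1_η); typed as an input; the classes
served (O10-PS, O7-ss ∩ `e = 2`, O5a) stay OPEN; nothing booked.
[cite: Kobayashi2003, Thm. 9.3 (p. 26), Lemma 9.1 (p. 25), Thm. 7.4 (p. 13), §4 (p. 8), §2 (p. 4: m = −1)]
[cite: GreenbergLNM1716, §3 Lemma 3.3 and §4 Lemma 4.2 (p. 102)]
[cite: KitajimaOtsuki2018, Main Thm. 1.3 (arXiv:1607.03612 p. 3)] -/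
@[conjecture] def QuadraticBranchOddStrictExactControlOfPlusMCAt (W : WeierstrassCurve ℚ)
    [W.IsElliptic] [W.IsGloballyMinimal] (p : ℕ) [Fact p.Prime] : Prop :=
  ∀ (V : WeierstrassCurve ℚ) [V.IsElliptic] [V.IsGloballyMinimal] (C : VariableChange ℚ)
    {N : ℕ} [NeZero N] {f : CuspForm (Gamma0 N) 2},
    5 ≤ p → C • W.quadraticTwist ((-1) ^ (p / 2) * p) = V →
    V.HasGoodReductionAtPrime p → V.frobeniusTrace p = 0 → W.analyticRank = 1 →
    QuadraticBranchPlusMainConjectureAt V p →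
    IsNewformOf V f →
    ∀ (ϖ : ℚ), (if Even (p / 2) then (ϖ : ℝ) * V.realPeriodRat = plusPeriod f
        else (ϖ : ℝ) * V.imaginaryPeriodRat = minusPeriod f) →
    ∀ (L : IwasawaAlgebra p), IsQuadraticBranchMinusLFunction f p ϖ L →
    (∀ Q : (W.baseChange ℚ_[p]).toAffine.Point, p • Q = 0 → Q = 0) →
    ∀ (P : W.toAffine.Point) (n : ℕ), ¬ IsOfFinAddOrder P →
    (∀ R : W.toAffine.Point, ∃ (k : ℤ) (T : W.toAffine.Point), IsOfFinAddOrder T ∧ R = k • P + T) →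
    (∃ Q : (W.baseChange ℚ_[p]).toAffine.Point, p ^ n • Q = W.toPadicPoint p P) →
    (∀ Q : (W.baseChange ℚ_[p]).toAffine.Point, p ^ (n + 1) • Q ≠ W.toPadicPoint p P) →
    PowerSeries.coeff 1 L ≠ 0 →
    Finite ↥(strictSelmerPInfty W p) ∧
      (padicValNat p (Nat.card ↥(strictSelmerPInfty W p)) : ℤ) + n +
          padicValRat p ((W.tamagawaProduct : ℚ) / (W.torsionOrder : ℚ) ^ 2) =
        ((PowerSeries.coeff 1 L : ℤ_[p]) : ℚ_[p]).valuation

/-! ## §3 ELEMENTARY typed input: the index of the strict group over `Ш[p^∞]` in rank one -/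

/-- **TYPED INPUT (ELEMENTARY — a theorem-level statement NOT yet in the kernel, tagged only so that
it is tracked until discharged, like its sibling `StrictSelmerDominatesShaAt` ↦
`StrictSha.strictSelmerDominatesShaAt_holds`; NOTHING asserted): `#Sel_str(W/ℚ)[p^∞] = p^ν · #Ш(W)[p^∞]`
in rank one.** If `P ∈ W(ℚ)` has infinite order and generates `W(ℚ)` modulo torsion, `W(ℚ_p)` has no
point of order `p`, and the image of `P` in `W(ℚ_p)` is divisible by `pⁿ` and not by `pⁿ⁺¹`, then
`Nat.card Sel_str(W/ℚ)[p^∞] = pⁿ · Nat.card Ш(W)[p^∞]` (`Nat.card = 0` on both sides when `Ш[p^∞]`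
is infinite). Proof sketch (x1b GEN 29 AMENDMENT 1 §B "by the snake lemma on `Sel_{p^∞}(W/ℚ) →
W(ℚ_p) ⊗ ℚ_p/ℤ_p`"; n1011-p01's `StrictSelmerDominatesSha(Algebra)` files give the surjection
`Sel_str ↠ Ш[p^∞]`): its kernel is `Sel_str ∩ im(W(ℚ) ⊗ ℚ_p/ℤ_p)` = the Kummer classes of
`P ⊗ a/p^m` that die in `H¹(ℚ_p, W[p^∞])`, i.e. with `(loc P) ⊗ a/p^m = 0` in `W(ℚ_p) ⊗ ℚ_p/ℤ_p ≅
ℚ_p/ℤ_p` (`W(ℚ_p) ≅ ℤ_p × (finite of order prime to p)`, AEC VII.6.3 + the no-`p`-torsion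
hypothesis, under which the `ℤ_p`-coordinate of `loc P` has valuation exactly `n`) ⟺ `v_p(a) + n ≥ m`:
a cyclic group of order `pⁿ`. Greenberg LNM 1716 §2 pp. 62–63; Kurihara–Pollack 2007 §1.5. A prover
target (P4♯), size S–M over `StrictSelmerDominatesShaAlgebra`. [cite: GreenbergLNM1716, §2 (pp. 62–63)]
[cite: KuriharaPollack2007, §1.5 (p. 361)] [cite: SilvermanAEC2009, Prop. VII.6.3] -/
@[conjecture] def StrictSelmerIndexAt (W : WeierstrassCurve ℚ) [W.IsElliptic] (p : ℕ)
    [Fact p.Prime] : Prop :=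
  ∀ (P : W.toAffine.Point) (n : ℕ), ¬ IsOfFinAddOrder P →
    (∀ R : W.toAffine.Point, ∃ (k : ℤ) (T : W.toAffine.Point), IsOfFinAddOrder T ∧ R = k • P + T) →
    (∀ Q : (W.baseChange ℚ_[p]).toAffine.Point, p • Q = 0 → Q = 0) →
    (∃ Q : (W.baseChange ℚ_[p]).toAffine.Point, p ^ n • Q = W.toPadicPoint p P) →
    (∀ Q : (W.baseChange ℚ_[p]).toAffine.Point, p ^ (n + 1) • Q ≠ W.toPadicPoint p P) →
    Nat.card ↥(strictSelmerPInfty W p) =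
      p ^ n * Nat.card (AddCommGroup.primaryComponent W.sha p)

section Index

variable {W : WeierstrassCurve ℚ} [W.IsElliptic] {p : ℕ} [Fact p.Prime]

/-- The index identity implies the (discharged) divisibility `#Ш[p^∞] ∣ #Sel_str` at any pair
carrying the data — consistency bookkeeping with §4 of p259634. [cite: GreenbergLNM1716, §2 (pp. 62–63)] -/
theorem StrictSelmerIndexAt.card_sha_dvd (h : StrictSelmerIndexAt W p) {P : W.toAffine.Point} {n : ℕ}
    (hP : ¬ IsOfFinAddOrder P)
    (hgen : ∀ R : W.toAffine.Point, ∃ (k : ℤ) (T : W.toAffine.Point),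
      IsOfFinAddOrder T ∧ R = k • P + T)
    (htors : ∀ Q : (W.baseChange ℚ_[p]).toAffine.Point, p • Q = 0 → Q = 0)
    (hdiv : ∃ Q : (W.baseChange ℚ_[p]).toAffine.Point, p ^ n • Q = W.toPadicPoint p P)
    (hndiv : ∀ Q : (W.baseChange ℚ_[p]).toAffine.Point, p ^ (n + 1) • Q ≠ W.toPadicPoint p P) :
    Nat.card (AddCommGroup.primaryComponent W.sha p) ∣ Nat.card ↥(strictSelmerPInfty W p) :=
  ⟨p ^ n, by rw [h P n hP hgen htors hdiv hndiv, mul_comm]⟩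

/-- With `Ш(W)[p^∞]` finite, the index identity reads `ord_p #Sel_str = n + ord_p #Ш(W)[p^∞]`.
Bookkeeping. [cite: GreenbergLNM1716, §2 (pp. 62–63)] -/
theorem StrictSelmerIndexAt.padicValNat_card_eq (h : StrictSelmerIndexAt W p) {P : W.toAffine.Point}
    {n : ℕ} (hP : ¬ IsOfFinAddOrder P)
    (hgen : ∀ R : W.toAffine.Point, ∃ (k : ℤ) (T : W.toAffine.Point),
      IsOfFinAddOrder T ∧ R = k • P + T)
    (htors : ∀ Q : (W.baseChange ℚ_[p]).toAffine.Point, p • Q = 0 → Q = 0)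
    (hdiv : ∃ Q : (W.baseChange ℚ_[p]).toAffine.Point, p ^ n • Q = W.toPadicPoint p P)
    (hndiv : ∀ Q : (W.baseChange ℚ_[p]).toAffine.Point, p ^ (n + 1) • Q ≠ W.toPadicPoint p P)
    [Finite (AddCommGroup.primaryComponent W.sha p)] :
    padicValNat p (Nat.card ↥(strictSelmerPInfty W p)) =
      n + padicValNat p (Nat.card (AddCommGroup.primaryComponent W.sha p)) := by
  have hne : Nat.card (AddCommGroup.primaryComponent W.sha p) ≠ 0 := Nat.card_pos.ne'
  have hpn : p ^ n ≠ 0 := pow_ne_zero n (Fact.out : p.Prime).ne_zero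
  rw [h P n hP hgen htors hdiv hndiv, padicValNat.mul hpn hne, padicValNat.prime_pow]

end Index

/-! ## §4 PROVED consumer: (C1_η) ∧ (C2_η-GZ) ∧ (C3_η) (+ the index) ⟹ `BSD(W, p)`, `PPart W p`

The (C2_η-GZ) input is taken in the form `QuadraticBranchMinusLeadingValuationAt W p 0`, which IS
`QuadraticBranchPAdicGrossZagierValuationAt W p` of the sibling file (`Iff.rfl` there), so that the
two files are independent. -/

section Consumers

variable (W : WeierstrassCurve ℚ) [W.IsElliptic] [W.IsGloballyMinimal] (p : ℕ) [Fact p.Prime]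
  {V : WeierstrassCurve ℚ} [V.IsElliptic] [V.IsGloballyMinimal] {C : VariableChange ℚ}
  {N : ℕ} [NeZero N] {f : CuspForm (Gamma0 N) 2} {ϖ : ℚ} {L : IwasawaAlgebra p}
  {P : W.toAffine.Point} {n : ℕ}

/-- **END-TO-END (PROVED over the typed inputs; CONDITIONAL on them; nothing booked): (C1_η) at the
twin ∧ (C2_η-GZ) (valuation content, `QuadraticBranchMinusLeadingValuationAt W p 0` =
`QuadraticBranchPAdicGrossZagierValuationAt W p`) ∧ (C3_η) ∧ the elementary index, at a pair `(W, p)` carrying the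
data (`p ≥ 5`, `V` the good `a_p = 0` twist, newform `f`, period ratio `ϖ`, an `L` with the
interpolation property of `L_p⁻(V, η, X)`, `W(ℚ_p)` with no `p`-torsion, a generator `P` of
`p`-divisibility level `n`), of analytic rank one ⟹ Miller's `BSD(W, p)`.** Arithmetic:
(C3_η) `ord_p #Sel_str + n + ord_p(Tam/#tors²) = v`; index `ord_p #Sel_str = n + ord_p #Ш(p)`;
(C2_η-GZ) `v = 2n + ord_p(#Ш_an · Tam/#tors²)` with `#Ш_an ∈ ℚ^×` (Gross–Zagier I.(7.3) `hGZ`,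
modularity `hmod`); hence `ord_p #Ш(W)(p) = ord_p #Ш_an(W)`; `rank = r_an` and finiteness by GZK
`hGZK`. This is the kernel form of x1b's "(C1_η) ∧ (C2_η-GZ) ∧ (C3_η) ⟹ `PPart`" (AMENDMENT 1 §C),
refining p254895's `QuadraticBranchRankOneLinkAt`; every input is a typed `@[conjecture]`, none is a
theorem of the published record; the classes served stay OPEN. [cite: Miller2011LMS, §1 and Def. 1.1]
[cite: GrossZagier1986, Thm. I.(7.3) 2) (p. 231)] [cite: Darmon2004, Thm. 3.22]
[cite: Kobayashi2003, §4 (p. 8), Thm. 7.4 (p. 13), Thm. 9.3 (p. 26)] -/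
theorem bsdp_of_quadraticBranchPAdicGrossZagierValuation_of_exactControl
    (hmod : hasEntireLFunction_rat) (hGZ : GrossZagier1986_thm_I_7_3)
    (hGZK : rank_eq_analyticRank_of_analyticRank_le_one)
    (h2 : QuadraticBranchMinusLeadingValuationAt W p 0)
    (h3 : QuadraticBranchOddStrictExactControlOfPlusMCAt W p) (hidx : StrictSelmerIndexAt W p)
    (hp : 5 ≤ p) (hC : C • W.quadraticTwist ((-1) ^ (p / 2) * p) = V)
    (hgood : V.HasGoodReductionAtPrime p) (hap : V.frobeniusTrace p = 0)
    (h1 : QuadraticBranchPlusMainConjectureAt V p) (hf : IsNewformOf V f)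
    (hϖ : if Even (p / 2) then (ϖ : ℝ) * V.realPeriodRat = plusPeriod f
        else (ϖ : ℝ) * V.imaginaryPeriodRat = minusPeriod f)
    (hL : IsQuadraticBranchMinusLFunction f p ϖ L)
    (htors : ∀ Q : (W.baseChange ℚ_[p]).toAffine.Point, p • Q = 0 → Q = 0)
    (hP : ¬ IsOfFinAddOrder P)
    (hgen : ∀ R : W.toAffine.Point, ∃ (k : ℤ) (T : W.toAffine.Point),
      IsOfFinAddOrder T ∧ R = k • P + T)
    (hdiv : ∃ Q : (W.baseChange ℚ_[p]).toAffine.Point, p ^ n • Q = W.toPadicPoint p P)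
    (hndiv : ∀ Q : (W.baseChange ℚ_[p]).toAffine.Point, p ^ (n + 1) • Q ≠ W.toPadicPoint p P)
    (hr : W.analyticRank = 1) : BSDp W p := by
  obtain ⟨hrank, hfin⟩ := hGZK W hr.le
  haveI : Finite W.sha := hfin
  -- `#Ш_an ∈ ℚ^×`
  obtain ⟨s, hs⟩ := Disegni2020.exists_rat_shaAn_eq_of_analyticRank_eq_one hGZ hGZK W hr
  have hs0 : s ≠ 0 := by
    rintro rfl
    exact AdditivePotMult.shaAn_ne_zero W hmod (by rw [hs, Rat.cast_zero])
  have hc : (W.tamagawaProduct : ℚ) ≠ 0 := by exact_mod_cast W.tamagawaProduct_pos_holds.ne'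
  have ht : (W.torsionOrder : ℚ) ≠ 0 := by exact_mod_cast W.torsionOrder_pos_holds.ne'
  have hct : (W.tamagawaProduct : ℚ) / (W.torsionOrder : ℚ) ^ 2 ≠ 0 :=
    div_ne_zero hc (pow_ne_zero 2 ht)
  -- (C2_η-GZ): `coeff₁ L ≠ 0` and `v = 2n + ord_p(s · Tam/#tors²)`
  obtain ⟨hne, hv2⟩ := h2 V C hp hC hgood hap hr hf ϖ hϖ L hL htors P n hP hgen hdiv hndiv s hs
  have hsplit : padicValRat p (s * W.tamagawaProduct / (W.torsionOrder : ℚ) ^ 2) =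
      padicValRat p s + padicValRat p ((W.tamagawaProduct : ℚ) / (W.torsionOrder : ℚ) ^ 2) := by
    rw [mul_div_assoc, padicValRat.mul hs0 hct]
  -- (C3_η): `ord_p #Sel_str + n + ord_p(Tam/#tors²) = v`
  obtain ⟨-, hv3⟩ := h3 V C hp hC hgood hap hr h1 hf ϖ hϖ L hL htors P n hP hgen hdiv hndiv hne
  -- the index: `ord_p #Sel_str = n + ord_p #Ш(p)`
  haveI : Finite (AddCommGroup.primaryComponent W.sha p) := inferInstance
  have hI := hidx.padicValNat_card_eq hP hgen htors hdiv hndiv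
  refine ⟨hrank, inferInstance, s, hs, ?_⟩
  rw [hI, Nat.cast_add] at hv3
  rw [hsplit, add_zero] at hv2
  linarith

/-- … hence the cell's general print shape **`PPart W p`** (x1b's wanted conclusion; `pPart_of_bsdp`)
and the typed output `MissingPPartAt W p`. CONDITIONAL on the typed inputs; nothing booked.
[cite: Miller2011LMS, §1 and Def. 1.1] [cite: YanZhu2026, Thm. 4.15 (display; shape only)] -/
theorem pPart_of_quadraticBranchPAdicGrossZagierValuation_of_exactControl
    (hmod : hasEntireLFunction_rat) (hGZ : GrossZagier1986_thm_I_7_3)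
    (hGZK : rank_eq_analyticRank_of_analyticRank_le_one)
    (h2 : QuadraticBranchMinusLeadingValuationAt W p 0)
    (h3 : QuadraticBranchOddStrictExactControlOfPlusMCAt W p) (hidx : StrictSelmerIndexAt W p)
    (hp : 5 ≤ p) (hC : C • W.quadraticTwist ((-1) ^ (p / 2) * p) = V)
    (hgood : V.HasGoodReductionAtPrime p) (hap : V.frobeniusTrace p = 0)
    (h1 : QuadraticBranchPlusMainConjectureAt V p) (hf : IsNewformOf V f)
    (hϖ : if Even (p / 2) then (ϖ : ℝ) * V.realPeriodRat = plusPeriod f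
        else (ϖ : ℝ) * V.imaginaryPeriodRat = minusPeriod f)
    (hL : IsQuadraticBranchMinusLFunction f p ϖ L)
    (htors : ∀ Q : (W.baseChange ℚ_[p]).toAffine.Point, p • Q = 0 → Q = 0)
    (hP : ¬ IsOfFinAddOrder P)
    (hgen : ∀ R : W.toAffine.Point, ∃ (k : ℤ) (T : W.toAffine.Point),
      IsOfFinAddOrder T ∧ R = k • P + T)
    (hdiv : ∃ Q : (W.baseChange ℚ_[p]).toAffine.Point, p ^ n • Q = W.toPadicPoint p P)
    (hndiv : ∀ Q : (W.baseChange ℚ_[p]).toAffine.Point, p ^ (n + 1) • Q ≠ W.toPadicPoint p P)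
    (hr : W.analyticRank = 1) : Rank1Residual.PPart W p ∧ MissingPPartAt W p := by
  have hB := bsdp_of_quadraticBranchPAdicGrossZagierValuation_of_exactControl W p hmod hGZ hGZK h2 h3
    hidx hp hC hgood hap h1 hf hϖ hL htors hP hgen hdiv hndiv hr
  haveI : Finite W.sha := (hGZK W hr.le).2
  exact ⟨pPart_of_bsdp hmod hGZK W p hr.le hB, missingPPartAt_of_bsdp W p hB⟩

end Consumers

end Summit.BirchSwinnertonDyer.Rank1Residual.Additive

end
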